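import Mathlib.RingTheory.Localization.AtPrime.Basic
import Mathlib.RingTheory.Localization.Ideal
import Mathlib.RingTheory.Ideal.Quotient.Operations
import Mathlib.RingTheory.Ideal.Height
import Mathlib.RingTheory.Polynomial.IsIntegral
import Mathlib.RingTheory.Polynomial.Basic
import Mathlib.Algebra.MvPolynomial.Equiv
import Mathlib.RingTheory.MvPolynomial.Basic
import HarnessLib

/-!
# Local rings of a localization followed by a surjection; polynomial bookkeeping

Support file for crux stmt-ResolutionOfSingularities-15960
(`SectionAscent.FibrewiseClosedPoints`, line `registered`, stub `stub_certificateRegular`):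
pure commutative algebra used to identify the local ring of the strict transform of the generic
hypersurface section with a quotient of Nagata's function ring `R(t)`.

* `exists_primeSpectrum_ringEquiv_quotient` — if `θ : D → E` is such that every element of
  `E` is `θ(d) θ(s)⁻¹` for `s` in a multiplicative set `S` disjoint from a prime `𝔔`
  (`E = S⁻¹D / ker`), and `ker θ ⊆ 𝔔`, then `𝔮 = {e | e θ(s) = θ(q), q ∈ 𝔔}` is a prime of `E`
  over `𝔔` and `E_𝔮 ≅ D_𝔔 / (ker θ) D_𝔔` for any localization `D_𝔔` of `D` at `𝔔`;
* `isIntegrallyClosed_mvPolynomial_fin` — `R[t₁, …, t_n]` is normal for a normal domain `R`;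
* `comap_C_map_C`, `isPrime_map_C`, `height_le_height_map_C`, `eq_of_le_of_height_eq_one` —
  extended primes `𝔭 R[t]` and heights.

References: H. Matsumura, *Commutative Ring Theory*, §4 (localization) and §15 (heights in
polynomial extensions); everything here is folklore. No definitions are introduced.
-/

-- single-problem summit: the doubled namespace component is forced
set_option linter.dupNamespace false

noncomputable section

namespace Summit.ResolutionOfSingularities.ResolutionOfSingularities.Theorems.SectionAscent.CertificateRegular

/-! ## Local rings of `E = S⁻¹D / J` -/

/-- **Local rings of a localization followed by a surjection.** Let `θ : D → E`, `S ⊆ D`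
multiplicative, `𝔔 ⊆ D` prime with `S ∩ 𝔔 = ∅`, such that every `e ∈ E` satisfies
`e θ(s) = θ(d)` for some `s ∈ S` (i.e. `E = S⁻¹D/J`), and `ker θ ⊆ 𝔔`. Then the ideal
`𝔮 = {e | e θ(s) = θ(q) for some s ∈ S, q ∈ 𝔔}` (`= 𝔔E`) is a prime of `E` with
`θ⁻¹(𝔮) = 𝔔`, and for any localization `T` of `D` at `𝔔` the natural map `T → E_𝔮` is
surjective with kernel `(ker θ) T`, whence `E_𝔮 ≅ T/(ker θ)T`. [folklore] -/
theorem exists_primeSpectrum_ringEquiv_quotient {D E : Type*} [CommRing D] [CommRing E]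
    (θ : D →+* E) (S : Submonoid D) (𝔔 : Ideal D) [𝔔.IsPrime]
    (hgen : ∀ e : E, ∃ s ∈ S, ∃ d : D, e * θ s = θ d) (hS𝔔 : ∀ s ∈ S, s ∉ 𝔔)
    (hker : ∀ d : D, θ d = 0 → d ∈ 𝔔)
    (T : Type*) [CommRing T] [Algebra D T] [IsLocalization.AtPrime T 𝔔] :
    ∃ 𝔮 : PrimeSpectrum E, 𝔮.asIdeal.comap θ = 𝔔 ∧
      Nonempty (Localization.AtPrime 𝔮.asIdeal ≃+* T ⧸ (RingHom.ker θ).map (algebraMap D T)) := by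
  -- the ideal `𝔔 E`, without denominators
  let J : Ideal E :=
    { carrier := {e | ∃ s ∈ S, ∃ q ∈ 𝔔, e * θ s = θ q}
      zero_mem' := ⟨1, S.one_mem, 0, 𝔔.zero_mem, by simp⟩
      add_mem' := by
        rintro e₁ e₂ ⟨s₁, hs₁, q₁, hq₁, h₁⟩ ⟨s₂, hs₂, q₂, hq₂, h₂⟩
        refine ⟨s₁ * s₂, S.mul_mem hs₁ hs₂, q₁ * s₂ + q₂ * s₁,
          𝔔.add_mem (𝔔.mul_mem_right _ hq₁) (𝔔.mul_mem_right _ hq₂), ?_⟩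
        rw [map_mul, map_add, map_mul, map_mul, ← h₁, ← h₂]
        ring
      smul_mem' := by
        rintro c e ⟨s, hs, q, hq, h⟩
        obtain ⟨s', hs', d', h'⟩ := hgen c
        refine ⟨s' * s, S.mul_mem hs' hs, d' * q, 𝔔.mul_mem_left _ hq, ?_⟩
        rw [smul_eq_mul, map_mul, map_mul, ← h, ← h']
        ring }
  have hJ : ∀ e : E, e ∈ J ↔ ∃ s ∈ S, ∃ q ∈ 𝔔, e * θ s = θ q := fun e => Iff.rfl
  -- `θ⁻¹(J) = 𝔔`
  have hθJ : ∀ d : D, θ d ∈ J ↔ d ∈ 𝔔 := by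
    intro d
    constructor
    · rintro ⟨s, hs, q, hq, h⟩
      have h0 : θ (d * s - q) = 0 := by rw [map_sub, map_mul, h, sub_self]
      have h1 : d * s ∈ 𝔔 := by simpa using 𝔔.add_mem (hker _ h0) hq
      exact (Ideal.IsPrime.mem_or_mem ‹_› h1).resolve_right (hS𝔔 s hs)
    · intro hd
      exact ⟨1, S.one_mem, d, hd, by simp⟩
  -- `J` is prime
  have hJprime : J.IsPrime := by
    refine ⟨?_, ?_⟩
    · intro htop
      have h1 : θ 1 ∈ J := by rw [htop]; trivial
      rw [hθJ] at h1
      exact (Ideal.IsPrime.ne_top ‹_›) ((Ideal.eq_top_iff_one _).mpr h1)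
    · intro e₁ e₂ h
      obtain ⟨s₁, hs₁, d₁, h₁⟩ := hgen e₁
      obtain ⟨s₂, hs₂, d₂, h₂⟩ := hgen e₂
      have hmem : θ (d₁ * d₂) ∈ J := by
        have : θ (d₁ * d₂) = e₁ * e₂ * θ (s₁ * s₂) := by
          rw [map_mul, map_mul, ← h₁, ← h₂]; ring
        rw [this]
        exact Ideal.mul_mem_right _ _ h
      rw [hθJ] at hmem
      rcases Ideal.IsPrime.mem_or_mem ‹_› hmem with hd | hd
      · exact Or.inl ⟨s₁, hs₁, d₁, hd, h₁⟩
      · exact Or.inr ⟨s₂, hs₂, d₂, hd, h₂⟩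
  let 𝔮 : PrimeSpectrum E := ⟨J, hJprime⟩
  have hcomap : 𝔮.asIdeal.comap θ = 𝔔 := Ideal.ext fun d => hθJ d
  refine ⟨𝔮, hcomap, ?_⟩
  let E' := Localization.AtPrime 𝔮.asIdeal
  have hle : 𝔔.primeCompl ≤ (𝔮.asIdeal.primeCompl).comap θ := by
    intro u hu
    change θ u ∉ 𝔮.asIdeal
    rw [← Ideal.mem_comap, hcomap]
    exact hu
  let Λ : T →+* E' := IsLocalization.map E' θ hle
  -- elements outside `𝔮` have numerators outside `𝔔`
  have hnum : ∀ {v : E} {s d : D}, v ∉ 𝔮.asIdeal → s ∈ S → v * θ s = θ d → d ∉ 𝔔 :=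
    fun hv hs h hd => hv ⟨_, hs, _, hd, h⟩
  -- surjectivity
  have hsurj : Function.Surjective Λ := by
    intro z
    obtain ⟨⟨e, v⟩, rfl⟩ := IsLocalization.mk'_surjective 𝔮.asIdeal.primeCompl z
    obtain ⟨s₁, hs₁, d₁, h₁⟩ := hgen e
    obtain ⟨s₂, hs₂, d₂, h₂⟩ := hgen v
    have hd₂ : d₂ ∉ 𝔔 := hnum v.2 hs₂ h₂
    have hden : d₂ * s₁ ∈ 𝔔.primeCompl := fun h =>
      (Ideal.IsPrime.mem_or_mem ‹_› h).elim hd₂ (hS𝔔 s₁ hs₁)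
    refine ⟨IsLocalization.mk' T (d₁ * s₂) ⟨d₂ * s₁, hden⟩, ?_⟩
    rw [IsLocalization.map_mk']
    apply IsLocalization.mk'_eq_iff_eq.mpr
    apply congrArg (algebraMap E E')
    change (v : E) * θ (d₁ * s₂) = θ (d₂ * s₁) * e
    rw [map_mul, map_mul, ← h₁, ← h₂]
    ring
  -- kernel
  have hkerΛ : RingHom.ker Λ = (RingHom.ker θ).map (algebraMap D T) := by
    apply le_antisymm
    · intro z hz
      obtain ⟨⟨x, y⟩, rfl⟩ := IsLocalization.mk'_surjective 𝔔.primeCompl z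
      rw [RingHom.mem_ker, IsLocalization.map_mk', IsLocalization.mk'_eq_zero_iff] at hz
      obtain ⟨⟨w, hw⟩, hwx⟩ := hz
      obtain ⟨s, hs, d, h⟩ := hgen w
      have hd : d ∉ 𝔔 := hnum hw hs h
      have hdx : d * x ∈ RingHom.ker θ := by
        rw [RingHom.mem_ker, map_mul, ← h]
        change w * θ s * θ x = 0
        rw [mul_right_comm]
        change (w * θ x) * θ s = 0
        rw [hwx, zero_mul]
      rw [IsLocalization.mem_map_algebraMap_iff 𝔔.primeCompl T]
      refine ⟨⟨⟨d * x, hdx⟩, ⟨d * y, fun h' => (Ideal.IsPrime.mem_or_mem ‹_› h').elim hd y.2⟩⟩, ?_⟩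
      change IsLocalization.mk' T x y * algebraMap D T (d * y) = algebraMap D T (d * x)
      rw [map_mul, map_mul, mul_left_comm, IsLocalization.mk'_spec T x y]
    · rw [Ideal.map_le_iff_le_comap]
      intro k hk
      rw [Ideal.mem_comap, RingHom.mem_ker, IsLocalization.map_eq, RingHom.mem_ker.mp hk, map_zero]
  exact ⟨(Ideal.quotEquivOfEq hkerΛ).symm.trans (RingHom.quotientKerEquivOfSurjective hsurj) |>.symm⟩

/-! ## Polynomial rings: normality, extended primes, heights -/

/-- `R[t₁, …, t_n]` is integrally closed for an integrally closed domain `R` (Mathlib has the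
one-variable case; induct on `n`). [folklore] -/
theorem isIntegrallyClosed_mvPolynomial_fin (R : Type*) [CommRing R] [IsDomain R]
    [IsIntegrallyClosed R] : ∀ n : ℕ, IsIntegrallyClosed (MvPolynomial (Fin n) R)
  | 0 => IsIntegrallyClosed.of_equiv (MvPolynomial.isEmptyAlgEquiv R (Fin 0)).toRingEquiv.symm
  | n + 1 => by
      haveI := isIntegrallyClosed_mvPolynomial_fin R n
      exact IsIntegrallyClosed.of_equiv (MvPolynomial.finSuccEquiv R n).toRingEquiv.symm

section Poly

variable {R : Type*} [CommRing R] {σ : Type*}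

/-- `𝔭 R[t] ∩ R = 𝔭`. [folklore] -/
theorem comap_C_map_C (p : Ideal R) :
    (p.map (MvPolynomial.C : R →+* MvPolynomial σ R)).comap MvPolynomial.C = p := by
  classical
  ext r
  rw [Ideal.mem_comap, MvPolynomial.mem_map_C_iff]
  constructor
  · intro h
    simpa using h 0
  · intro h m
    rw [MvPolynomial.coeff_C]
    split_ifs
    exacts [h, p.zero_mem]

/-- `𝔭 R[t]` is prime for a prime `𝔭` (it is the kernel of `R[t] → (R/𝔭)[t]`). [folklore] -/
theorem isPrime_map_C (p : Ideal R) [p.IsPrime] :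
    (p.map (MvPolynomial.C : R →+* MvPolynomial σ R)).IsPrime := by
  have : p.map MvPolynomial.C =
      RingHom.ker (MvPolynomial.map (σ := σ) (Ideal.Quotient.mk p)) := by
    rw [MvPolynomial.ker_map, Ideal.mk_ker]
  rw [this]
  exact RingHom.ker_isPrime _

/-- `ht 𝔭 ≤ ht 𝔭R[t]`: `𝔮 ↦ 𝔮 R[t]` is strictly increasing on primes. [folklore] -/
theorem height_le_height_map_C (p : Ideal R) [p.IsPrime] :
    p.height ≤ (p.map (MvPolynomial.C : R →+* MvPolynomial σ R)).height := by
  let f : PrimeSpectrum R → PrimeSpectrum (MvPolynomial σ R) :=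
    fun q => ⟨q.asIdeal.map MvPolynomial.C, isPrime_map_C q.asIdeal⟩
  have hmono : Monotone f := fun q₁ q₂ h => Ideal.map_mono h
  have hinj : Function.Injective f := by
    intro q₁ q₂ h
    ext1
    rw [← comap_C_map_C (σ := σ) q₁.asIdeal, ← comap_C_map_C (σ := σ) q₂.asIdeal]
    exact congrArg (fun q : PrimeSpectrum (MvPolynomial σ R) => q.asIdeal.comap MvPolynomial.C) h
  have h := Order.height_le_height_apply_of_strictMono f (hmono.strictMono_of_injective hinj) ⟨p, ‹_›⟩
  rw [← PrimeSpectrum.height_eq_orderHeight, ← PrimeSpectrum.height_eq_orderHeight] at h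
  exact h

/-- In a domain, a non-zero prime inside a height-one prime is all of it. [folklore] -/
theorem eq_of_le_of_height_eq_one [IsDomain R] {P Q : Ideal R} [P.IsPrime] [Q.IsPrime]
    (hQ : Q ≠ ⊥) (hle : Q ≤ P) (hP : P.height = 1) : Q = P := by
  by_contra hne
  have hlt : Q < P := lt_of_le_of_ne hle hne
  have h1 := Ideal.height_add_one_le_of_lt_of_isPrime hlt
  rw [hP] at h1
  have hQ0 : Q.height ≠ 0 := fun h0 => hQ (Ideal.height_eq_zero_iff_eq_bot.mp h0)
  have h2 : (1 : ℕ∞) ≤ Q.height := Order.one_le_iff_ne_zero.mpr hQ0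
  have h3 : (1 : ℕ∞) + 1 ≤ 1 := le_trans (add_le_add h2 le_rfl) h1
  exact absurd h3 (by decide)

end Poly

/-- **Registered form** (`stub_certificateRegularLocQuot`): local rings of a localization followed
by a surjection, `E_𝔮 ≅ T/(ker θ)T` — see `exists_primeSpectrum_ringEquiv_quotient`. [folklore] -/
theorem stub_certificateRegularLocQuot (D E : Type) [CommRing D] [CommRing E] (θ : D →+* E) (S : Submonoid D) (𝔔 : Ideal D) [𝔔.IsPrime] (hgen : ∀ e : E, ∃ s ∈ S, ∃ d : D, e * θ s = θ d) (hS𝔔 : ∀ s ∈ S, s ∉ 𝔔) (hker : ∀ d : D, θ d = 0 → d ∈ 𝔔) (T : Type) [CommRing T] [Algebra D T] [IsLocalization.AtPrime T 𝔔] : ∃ 𝔮 : PrimeSpectrum E, 𝔮.asIdeal.comap θ = 𝔔 ∧ Nonempty (Localization.AtPrime 𝔮.asIdeal ≃+* T ⧸ (RingHom.ker θ).map (algebraMap D T)) :=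
  exists_primeSpectrum_ringEquiv_quotient θ S 𝔔 hgen hS𝔔 hker T

end Summit.ResolutionOfSingularities.ResolutionOfSingularities.Theorems.SectionAscent.CertificateRegular

end
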